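import Mathlib.Data.Finsupp.Weight
import Literature.Computability.AlgebraicComplexity.MonomialChart
import Literature.Computability.AlgebraicComplexity.RankMethodBarriers
import HarnessLib

/-!
# Hankel factorisation and the support-splitting rank bound

Topic `Literature/Computability/AlgebraicComplexity`; theorems about the objects of
`MonomialChart.lean` (no new definitions).

* `phi_mul`: `φ_t(f h) = Σ_{β, β' ∈ D̄} coeff_β(f) · t̃(β + β') · coeff_{β'}(h)`.
* `map_phi_mul`, `rank_map_phi_mul_le`: for matrices of polynomials `P` (`p × k`) and `Q`
  (`k × q`), `φ_t(P Q) = Σ_l P̂_l H_t Q̂_l`, hence `rk φ_t(P Q) ≤ k · rk H_t` — the affine shadow of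
  Buczyński's Lemma 5 (a trivial rank-`k` bundle on a scheme of length `r` spans `≤ k r`
  dimensions). [Buczynski2026, Lemma 5, Thm. 9]
* `rank_hankel_le`: if all `|α l| ≤ e + e' + 1` then
  `rk H_t ≤ #{β ∈ D̄ : |β| ≤ e} + #{β ∈ D̄ : |β| ≤ e'}` (support splitting), and the Segre count
  `#{β ∈ D̄ : |β| ≤ 1} ≤ |σ| + 1` (`card_filter_degree_le_one_le`), giving Buczyński's
  `2(dim X + 1) = 2(a+b+c−2)` [Buczynski2026, §1.3].
* small product lemmas `prod_pow_single/add/sum` for `y^β = ∏_v y_v^{β v}`.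
-/

noncomputable section

open scoped BigOperators
open MvPolynomial

namespace Literature.Computability.AlgebraicComplexity

namespace MonomialChart

variable {F : Type*} [Field F]
variable {σ : Type*} {I : Type*}
variable {p q : Type*}

/-! ## Products of powers -/

section ProdPow

variable [Fintype σ]

/-- `y^0 = 1`. [folklore] -/
theorem prod_pow_zero (y : σ → F) : ∏ v, y v ^ ((0 : σ →₀ ℕ) v) = 1 := by simp

/-- `y^{e_v} = y_v`. [folklore] -/
theorem prod_pow_single [DecidableEq σ] (y : σ → F) (v : σ) :
    ∏ s, y s ^ (Finsupp.single v 1 s) = y v := by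
  rw [Finset.prod_eq_single v (fun s _ hs => by rw [Finsupp.single_eq_of_ne hs, pow_zero])
    (fun h => (h (Finset.mem_univ v)).elim), Finsupp.single_eq_same, pow_one]

/-- `y^{β + γ} = y^β y^γ`. [folklore] -/
theorem prod_pow_add (y : σ → F) (β γ : σ →₀ ℕ) :
    ∏ s, y s ^ ((β + γ) s) = (∏ s, y s ^ β s) * ∏ s, y s ^ γ s := by
  simp only [Finsupp.add_apply, pow_add, Finset.prod_mul_distrib]

/-- `y^{Σ_j β_j} = ∏_j y^{β_j}`. [folklore] -/
theorem prod_pow_sum (y : σ → F) {κ : Type*} (s : Finset κ) (β : κ → σ →₀ ℕ) :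
    ∏ v, y v ^ ((∑ j ∈ s, β j) v) = ∏ j ∈ s, ∏ v, y v ^ (β j v) := by
  classical
  induction s using Finset.induction_on with
  | empty => simp
  | insert a s ha ih => rw [Finset.sum_insert ha, Finset.prod_insert ha, prod_pow_add, ih]

end ProdPow

/-! ## Hankel factorisation -/

section Hankel

variable [Fintype I] [DecidableEq σ]

/-- **`φ_t` of a product is a Hankel pairing of the coefficient vectors**:
`φ_t(f h) = Σ_{β, β' ∈ D̄} coeff_β(f) · t̃(β+β') · coeff_{β'}(h)`. [folklore] -/
theorem phi_mul (α : I → σ →₀ ℕ) (t : I → F) (f h : MvPolynomial σ F) :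
    phi α t (f * h) = ∑ β ∈ downClosure α, ∑ β' ∈ downClosure α,
      coeff β f * coeffExt α t (β + β') * coeff β' h := by
  classical
  -- both sides as a sum over `l`
  have hR : ∀ l, (∑ β ∈ downClosure α, ∑ β' ∈ downClosure α,
      if α l = β + β' then t l * (coeff β f * coeff β' h) else 0) =
      t l * ∑ x ∈ Finset.antidiagonal (α l), coeff x.1 f * coeff x.2 h := by
    intro l
    rw [Finset.mul_sum, ← Finset.sum_product (downClosure α) (downClosure α)
      (fun x => if α l = x.1 + x.2 then t l * (coeff x.1 f * coeff x.2 h) else 0),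
      ← Finset.sum_filter]
    apply Finset.sum_congr _ (fun _ _ => rfl)
    ext x
    simp only [Finset.mem_filter, Finset.mem_product, mem_downClosure, Finset.mem_antidiagonal]
    constructor
    · rintro ⟨-, hx⟩; exact hx.symm
    · intro hx
      refine ⟨⟨⟨l, ?_⟩, ⟨l, ?_⟩⟩, hx.symm⟩
      · rw [← hx]; exact le_self_add
      · rw [← hx]; exact le_add_self
  calc phi α t (f * h) = ∑ l, t l * ∑ x ∈ Finset.antidiagonal (α l), coeff x.1 f * coeff x.2 h := by
        simp only [phi, coeff_mul]
    _ = ∑ l, ∑ β ∈ downClosure α, ∑ β' ∈ downClosure α,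
          if α l = β + β' then t l * (coeff β f * coeff β' h) else 0 := by
        refine Finset.sum_congr rfl fun l _ => (hR l).symm
    _ = ∑ β ∈ downClosure α, ∑ β' ∈ downClosure α,
          ∑ l, if α l = β + β' then t l * (coeff β f * coeff β' h) else 0 := by
        rw [Finset.sum_comm]
        refine Finset.sum_congr rfl fun β _ => ?_
        rw [Finset.sum_comm]
    _ = _ := by
        refine Finset.sum_congr rfl fun β _ => Finset.sum_congr rfl fun β' _ => ?_
        simp only [coeffExt, Finset.mul_sum, Finset.sum_mul]
        refine Finset.sum_congr rfl fun l _ => ?_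
        split_ifs <;> ring

/-- **Hankel factorisation.** For matrices of polynomials `P` (`p × k`) and `Q` (`k × q`),
`φ_t(P Q) = Σ_{l < k} P̂_l · H_t · Q̂_l` entrywise. [folklore] -/
theorem map_phi_mul (α : I → σ →₀ ℕ) (t : I → F) {k : ℕ}
    (P : Matrix p (Fin k) (MvPolynomial σ F)) (Q : Matrix (Fin k) q (MvPolynomial σ F)) :
    (P * Q).map (phi α t) = ∑ l,
      Matrix.of (fun a (β : downClosure α) => coeff β.1 (P a l)) * hankel α t *
        Matrix.of (fun (β : downClosure α) b => coeff β.1 (Q l b)) := by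
  ext a b
  rw [Matrix.map_apply, Matrix.mul_apply, phi_sum, Matrix.sum_apply]
  refine Finset.sum_congr rfl fun l _ => ?_
  rw [phi_mul, Matrix.mul_apply]
  simp only [Matrix.mul_apply, Matrix.of_apply, hankel, Finset.sum_mul]
  rw [Finset.sum_comm]
  rw [← Finset.sum_coe_sort (downClosure α)]
  refine Finset.sum_congr rfl fun β' _ => ?_
  rw [← Finset.sum_coe_sort (downClosure α)]

/-- **Rank bound from the Hankel factorisation**: `rk φ_t(P Q) ≤ k · rk H_t` when `P` has `k`
columns. This is the affine shadow of Buczyński's Lemma 5 (a rank-`k` trivial bundle on a scheme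
of length `r` spans at most `k r` dimensions). [cite: Buczynski2026, Lemma 5 and Thm. 9] -/
theorem rank_map_phi_mul_le [Fintype q] (α : I → σ →₀ ℕ) (t : I → F) {k : ℕ}
    (P : Matrix p (Fin k) (MvPolynomial σ F)) (Q : Matrix (Fin k) q (MvPolynomial σ F)) :
    ((P * Q).map (phi α t)).rank ≤ k * (hankel α t).rank := by
  rw [map_phi_mul]
  refine (matrix_rank_sum_le _ _).trans ?_
  calc ∑ l, (Matrix.of (fun a (β : downClosure α) => coeff β.1 (P a l)) * hankel α t *
        Matrix.of (fun (β : downClosure α) b => coeff β.1 (Q l b))).rank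
      ≤ ∑ _l : Fin k, (hankel α t).rank := by
        refine Finset.sum_le_sum fun l _ => ?_
        exact (Matrix.rank_mul_le_left _ _).trans (Matrix.rank_mul_le_right _ _)
    _ = k * (hankel α t).rank := by simp

/-! ## The support-splitting bound for the rank of the Hankel matrix -/

/-- `t̃(γ) ≠ 0` forces `γ` to be one of the exponents. [folklore] -/
theorem exists_eq_of_coeffExt_ne_zero {α : I → σ →₀ ℕ} {t : I → F} {γ : σ →₀ ℕ}
    (h : coeffExt α t γ ≠ 0) : ∃ l, α l = γ := by
  by_contra hne
  exact h (Finset.sum_eq_zero fun l _ => if_neg fun hl => hne ⟨l, hl⟩)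

/-- A matrix supported on the rows in `R` has rank at most `|R|`. [folklore] -/
theorem rank_le_card_of_rows {m n : Type*} [Fintype m] [Fintype n] [DecidableEq m]
    (A : Matrix m n F) (R : Finset m) (hA : ∀ i ∉ R, ∀ j, A i j = 0) :
    A.rank ≤ R.card := by
  classical
  have hE : A = Matrix.diagonal (fun i => if i ∈ R then (1 : F) else 0) * A := by
    ext i j
    rw [Matrix.diagonal_mul]
    by_cases hi : i ∈ R
    · simp [hi]
    · simp [hi, hA i hi j]
  rw [hE]
  refine (Matrix.rank_mul_le_left _ _).trans ?_
  rw [Matrix.rank_diagonal]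
  refine le_of_eq ?_
  rw [Fintype.card_subtype]
  congr 1; ext i; simp

/-- A matrix supported on the columns in `C` has rank at most `|C|`. [folklore] -/
theorem rank_le_card_of_cols {m n : Type*} [Fintype m] [Fintype n] [DecidableEq n]
    (A : Matrix m n F) (C : Finset n) (hA : ∀ j ∉ C, ∀ i, A i j = 0) :
    A.rank ≤ C.card := by
  classical
  have hE : A = A * Matrix.diagonal (fun j => if j ∈ C then (1 : F) else 0) := by
    ext i j
    rw [Matrix.mul_diagonal]
    by_cases hj : j ∈ C
    · simp [hj]
    · simp [hj, hA j hj i]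
  rw [hE]
  refine (Matrix.rank_mul_le_right _ _).trans ?_
  rw [Matrix.rank_diagonal]
  refine le_of_eq ?_
  rw [Fintype.card_subtype]
  congr 1; ext i; simp

/-- **Support splitting.** If every exponent has degree `≤ e + e' + 1`, then `H_t(β, β') ≠ 0`
forces `|β| ≤ e` or `|β'| ≤ e'`, whence
`rk H_t ≤ #{β ∈ D̄ : |β| ≤ e} + #{β' ∈ D̄ : |β'| ≤ e'}`. For the Segre chart (`e = e' = 1`) this
is the count `2 (dim X + 1)` of Bernardi–Ranestad / Buczyński §1.3; for the cube it is EGOW's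
`2^d n^{⌊d/2⌋}`. [cite: Buczynski2026, §1.3] -/
theorem rank_hankel_le (α : I → σ →₀ ℕ) (t : I → F) (e e' : ℕ)
    (hdeg : ∀ l, (α l).degree ≤ e + e' + 1) :
    (hankel α t).rank ≤
      ((downClosure α).filter fun β => β.degree ≤ e).card +
        ((downClosure α).filter fun β => β.degree ≤ e').card := by
  classical
  set H := hankel α t with hH
  -- split the rows at degree `e`
  set R : Finset (downClosure α) := Finset.univ.filter fun β => β.1.degree ≤ e with hR
  set H₁ : Matrix (downClosure α) (downClosure α) F :=
    fun β β' => if β ∈ R then H β β' else 0 with hH₁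
  set H₂ : Matrix (downClosure α) (downClosure α) F :=
    fun β β' => if β ∈ R then 0 else H β β' with hH₂
  have hsplit : H = H₁ + H₂ := by
    ext β β'
    simp only [hH₁, hH₂, Matrix.add_apply]
    split_ifs <;> simp
  have h₁ : H₁.rank ≤ ((downClosure α).filter fun β => β.degree ≤ e).card := by
    refine (rank_le_card_of_rows H₁ R fun β hβ β' => if_neg hβ).trans (le_of_eq ?_)
    rw [hR, Finset.card_filter, Finset.card_filter, ← Finset.sum_coe_sort (downClosure α)]
  have h₂ : H₂.rank ≤ ((downClosure α).filter fun β => β.degree ≤ e').card := by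
    set C : Finset (downClosure α) := Finset.univ.filter fun β => β.1.degree ≤ e' with hC
    refine (rank_le_card_of_cols H₂ C fun β' hβ' β => ?_).trans (le_of_eq ?_)
    · simp only [hH₂]
      split_ifs with hβ
      · rfl
      · -- `β ∉ R`, `β' ∉ C`: the entry vanishes by degree
        by_contra hne
        obtain ⟨l, hl⟩ := exists_eq_of_coeffExt_ne_zero hne
        have hd := hdeg l
        rw [hl, map_add] at hd
        simp only [hR, hC, Finset.mem_filter, Finset.mem_univ, true_and, not_le] at hβ hβ'
        omega
    · rw [hC, Finset.card_filter, Finset.card_filter, ← Finset.sum_coe_sort (downClosure α)]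
  calc H.rank = (H₁ + H₂).rank := by rw [hsplit]
    _ ≤ H₁.rank + H₂.rank := matrix_rank_add_le _ _
    _ ≤ _ := add_le_add h₁ h₂

omit [Fintype I] [DecidableEq σ] in
/-- An exponent of degree `≤ 1` is `0` or a unit vector `e_v`. [folklore] -/
theorem eq_zero_or_eq_single_of_degree_le_one {β : σ →₀ ℕ} (h : β.degree ≤ 1) :
    β = 0 ∨ ∃ v, β = Finsupp.single v 1 := by
  classical
  by_cases h0 : β = 0
  · exact Or.inl h0
  · right
    obtain ⟨v, hv⟩ : ∃ v, β v ≠ 0 := by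
      by_contra hne
      exact h0 (Finsupp.ext fun v => by simpa using not_exists.1 hne v)
    have hv1 : β v = 1 := le_antisymm ((Finsupp.le_degree v β).trans h) (Nat.pos_of_ne_zero hv)
    have hle : Finsupp.single v 1 ≤ β := Finsupp.single_le_iff.2 hv1.ge
    refine ⟨v, ?_⟩
    obtain ⟨γ, hγ⟩ := exists_add_of_le hle
    have hdeg : γ.degree = 0 := by
      have := congrArg Finsupp.degree hγ
      rw [map_add, Finsupp.degree_single] at this
      omega
    rw [hγ, (Finsupp.degree_eq_zero_iff γ).1 hdeg, add_zero]

/-- **The Segre count.** At most `|σ| + 1` exponents of degree `≤ 1` exist (the constant and the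
variables), so `#{β ∈ D̄ : |β| ≤ 1} ≤ |σ| + 1`. [folklore] -/
theorem card_filter_degree_le_one_le [Fintype σ] (α : I → σ →₀ ℕ) :
    ((downClosure α).filter fun β => β.degree ≤ 1).card ≤ Fintype.card σ + 1 := by
  classical
  set emb : Option σ → (σ →₀ ℕ) := fun o => o.elim 0 fun v => Finsupp.single v 1 with hemb
  calc ((downClosure α).filter fun β => β.degree ≤ 1).card
      ≤ (Finset.univ.image emb).card := by
        refine Finset.card_le_card fun β hβ => ?_
        rw [Finset.mem_filter] at hβ
        rw [Finset.mem_image]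
        rcases eq_zero_or_eq_single_of_degree_le_one hβ.2 with h | ⟨v, h⟩
        · exact ⟨none, Finset.mem_univ _, h.symm⟩
        · exact ⟨some v, Finset.mem_univ _, h.symm⟩
    _ ≤ (Finset.univ : Finset (Option σ)).card := Finset.card_image_le
    _ = Fintype.card σ + 1 := by rw [Finset.card_univ, Fintype.card_option]

end Hankel

end MonomialChart

end Literature.Computability.AlgebraicComplexity

end
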